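import Mathlib
import HarnessLib
import HarnessLib.Audit
import Summits.AtomisticToContinuum.Statement
import Literature.Geometry.DiscreteGeometry.KissingPatterns
import Literature.Geometry.DiscreteGeometry.FejesTothKissingTwelve
import Literature.MathematicalPhysics.StatisticalMechanics.BarlowStacking
import Literature.MathematicalPhysics.StatisticalMechanics.HaggStacking
import Summits.AtomisticToContinuum.Crystallization.Theorems.PalmUnimodularRigidityCrysPeriodicBddBelow

/-!
Route: HullExactification

CLOSED (retired) 2026-08-15T13:43:16Z by operator:999:1257524 — reason: not-a-thesis: assembly does not conclude the sub-problem Statement — note: D-0027 §2.1 audit (human 2026-08-15: routes that do not decide the summit are removed): the assembly concludes `Literature.MathematicalPhysics.StatisticalMechanics.Crystallization`, not the sub-problem statement; a NEW conforming route may be opened from the same idea (generated `closes : … → _root_. The file is kept as the record of this route; refuted decls are indexed as negative knowledge (`ledger negatives`).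

HULL EXACTIFICATION CASCADE (idea card hull-exactification-cascade). It suffices to show X = A ∧ B ∧
C:
 (A) ZeroDefectDensity — for every sequence of Lennard-Jones ground states x^N in ℝ³ the fraction of
particles i whose first shell (the other particles within 13/10·d_i, d_i = nearest-neighbour
distance of i), rescaled by d_i, is NOT 1/20-matched after a linear isometry to the fcc pattern
(cuboctahedron, tree fccKissingPattern) or the hcp pattern (anticuboctahedron, hcpKissingPattern)
tends to 0.
 (B) HcpLandscapeGap — there are hcp parameters (a*, h*) with 9/10 < a* < 1, |h* − a*√(2/3)| ≤
a*/100 such that for every uniformly discrete S ⊆ ℝ³ that is everywhere 1/20-good and carries a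
global Barlow template, for every η > 0: Σ_{y ∈ S∩B_L(c)} siteE_S(y) ≥ 2·e(hcp a* h*)·#(S∩B_L(c)) +
κ(η)·#{η-bad points in the ball} − C(L+1)², where y is η-bad if its unscaled first shell is not
η-congruent (linear isometry + bijection) to the first shell of hcpStacking a* h* at 0 —
density-priced strict minimality of the relaxed hcp crystal among perturbed close packings (Hägg
domination + harmonic stability; no rate in η is asked).
 (C) RobustBarlowTemplate — a uniformly discrete, nonempty, everywhere 1/20-good S is the bijective
image of the ideal Barlow stacking barlowStacking 1 √(2/3) s (some Hägg sequence s) under a map that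
is 1/20-close to a similarity on every 13-point cluster: the robust form of the PROVED
HalesDSP_layerPackings_holds with the pattern identification as INPUT (no Fejes Tóth theorem, exact
or robust, is needed for LJ).
HOW X GIVES THE CONJUNCT (all steps filed as typed support items). Ω(x) := local limits (two-sided
ε-matching on balls, as in CrystallizationLocalLimit.tendsto_sum_of_eventually_near') of translates
of subsequences of x. D HullGoodEverywhere: A ⟹ ∃ S₁ ∈ Ω(x), 0 ∈ S₁, everywhere 1/20-good
(EXACTIFICATION no. 1: zero density at a fixed tolerance ⟹ a defect-free hull element;
under-coordination is a defect, so S₁ is relatively dense). E HullBulkOptimal: every S ∈ Ω(x)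
satisfies Σ_{S∩B_L(c)} siteE ≤ 2e_∞·#(S∩B_L(c)) + εL³ (cut-and-paste on the finite ground states;
e_∞ = liminf E(N)/N, a limit by BlancLewin2015_8_holds). C gives S₁ a template, B prices η-bad
points, E caps the energy, J gives e* := e(hcp a* h*) ≤ e_∞; the arithmetic F₀ HullDefectDensityZero
then says η-bad points have density zero in S₁ for EVERY η > 0, and F HullExactShells
(EXACTIFICATION no. 2, inside Ω(x): limits of translates of hull elements are hull elements) yields
S₂ ∈ Ω(x), 0 ∈ S₂, every first shell EXACTLY congruent to the hcp(a*,h*) shell; G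
ExactHcpLocalTheorem (an η = 0 local theorem, valid off the ideal ratio) gives S₂ = g(hcpStacking a*
h*); H HullPeriodicCrystallizes turns a periodic point set in Ω(x) into Blanc–Lewin (16)
(multiplicity 1 by LennardJonesMinimalDistance_holds) ⟹ IsCrystallizing lennardJones 3. Conjunct
(i): J HullEnergyLowerBound (same hull argument: B with the κ-term dropped + E on S₁) gives e* ≤
e_∞; CrysEnergyUpper (item 0629) and CrysPeriodicBddBelow (0714) give e_∞ ≤ ⨅_Q e(Q) ≤ e*, hence e_∞
= min_Q e(Q) attained at hcpPeriodicConfiguration a* h* ⟹ HasPeriodicGroundStateEnergy lennardJones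
3. Only EXACT classification theorems are ever applied to hull elements; no rate, no R-window
matching of finite ground states, no stacking-fault counting, no N^{2/3} shape analysis.
Lean: ZeroDefectDensity → HcpLandscapeGap → RobustBarlowTemplate → HullGoodEverywhere →
HullBulkOptimal → HullDefectDensityZero → HullExactShells → ExactHcpLocalTheorem →
HullPeriodicCrystallizes → CrysEnergyUpper → CrysPeriodicBddBelow → HullEnergyLowerBound →
Literature.MathematicalPhysics.StatisticalMechanics.Crystallization

Rationale: WHY THIS LINE. Blanc–Lewin's positional statement (16) asks only that SOME translated subsequence of
ground states have SOME periodic local limit (BlancLewin2015 §2.1 (15)–(17)); the set Ω(x) of all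
local limits of translates — Radin's ground-state hull (Radin1991 §2–3, Radin1987; GardnerRadin1979
is the d = 1 Lennard-Jones instance) — is translation-closed and closed under re-taking local
limits, so a defect class of DENSITY ZERO is absent from some hull element. Iterating this
exactification (coordination → stacking/strain) means every analytic input is a zero-density
statement at a FIXED tolerance (crux A for the finite ground states; B+E for hull elements) and
every geometric input is an EXACT (η = 0) classification theorem of the kind the tree already holds
(HalesDSP_layerPackings_holds proved; FejesTothKissingTwelve named; here the new η = 0 item G, valid
off the ideal c/a). This is what distinguishes the line from route CrystalKissingRigidity (rank-2
crux 0758 = robust Fejes Tóth with LINEAR rate Cη and C(R)η window matching, threatened by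
BoroczkySzabo2016; hinge 0751 = R-window matching of finite ground states; 0759 fault counting) and
from CrystalLocalRigidity (a pointwise local inequality e_loc ≥ e*): no rate, no window matching, no
fault counting, no N^{2/3} shape analysis appear anywhere, and conjunct (i) drops out of the same
hull argument (J: "a hull element built on hcp* has e(hcp*) ≤ e_∞"). Imported areas, with
dictionary: topological dynamics of uniformly discrete point sets (orbit closure = Ω(x),
minimal-component heuristics; Radin1991, Levitov 1988 "weak local rules" doi:10.1007/bf01218348 as
the template for "robust local datum ⇒ global order", AuYeungFrieseckeSchmidt2012 for compactness
atop an exact 2-D theorem); discrete geometry of twelve-neighbour packings (Hales2012, HalesDSP2012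
§1.3, KusnerKusnerLagariasShlosman2018) for C and G; 1-D lattice-gas domination (HaggStacking.lean,
item 0737) and discrete elasticity / Cauchy–Born stability (FrieseckeTheil2002; E–Ming, ARMA 2007)
inside B.
RANKED CRUXES. #2 ZeroDefectDensity — LJ-specific heart: the fraction of particles whose rescaled
13/10·d-shell is not 1/20-close to the cuboctahedron/anticuboctahedron tends to 0 (why it might
fail: a positive density of polytetrahedral / Frank–Kasper environments in bulk LJ ground states, or
no local energy inequality that sees two shells — IcosahedralClusters, BlancLewin2015 §2.3,
FlatleyTheil2015 §1; source of hope: Stillinger2001 / PartayOrtnerCsanyi2017 numerics, equality-free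
certificate cards). #3 HcpLandscapeGap — density-priced strict minimality of relaxed hcp(a*,h*)
among everywhere-good templated uniformly discrete configurations (why it might fail: fcc or a
polytype below hcp — margins ≈ 1e-4·|e*|: Stillinger2001, BeterminSamajTravenec2022,
PartayOrtnerCsanyi2017 —, relaxation or soft modes eating the Peierls/Hägg gap of 0737 with the
couplings of 0670, or failure of a discrete Gårding inequality with the r⁻⁶ tail). #4
RobustBarlowTemplate — pure metric geometry, no potential (why it might fail: tolerance 1/20 too
generous for unambiguous layer propagation, e.g. layering directions twisting across fcc-type
regions; FlexibleKissingArrangements, BoroczkySzabo2016 ε-quasi-twelve-neighbour constructions; ε =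
0 is the proved HalesDSP_layerPackings_holds).
KILL CRITERIA. A refuted (a theorem or decisive numerics exhibiting a positive fraction of
non-close-packed bulk environments in LJ ground states) kills this and every sphere-packing-heritage
route. B refuted in the form "a periodic Barlow polytype P ≠ hcp is the strict minimiser" ⟹ restate
B, F, G with P (the line survives; G becomes the P-local theorem); B refuted as "no density-priced
gap at tolerance 1/20 for ANY periodic P" (aperiodic optimal stacking, marginal domination — cf.
route RefuteCrystalPeriodicMin, item 0668) closes the route. C refuted at 1/20 ⟹ restate A, B, C at
a smaller common tolerance (A becomes harder; the tolerance must stay FIXED because LJ-hcp has c/a ≠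
√(8/3), so shells are never exactly similar to the ideal patterns); C refuted at every fixed
tolerance uniformly in δ would contradict HalesDSP_layerPackings_holds + compactness only if the
compactness upgrade fails non-uniformly — then C is re-filed with a δ-dependent tolerance.
NOT DECOMPOSED YET. The interior of B: (B1) Hägg domination surviving (a,h)- and NON-uniform
interlayer relaxation (foreseen children: 0737 HaggDominationAllRanges + certified couplings 0670 +
a relaxation lemma), (B2) harmonic and geometric-nonlinear stability of LJ hcp (certified force
constants and elastic tensor; a Friesecke–Theil / E–Ming-type discrete Gårding inequality with
summable tail), (B3) boundary-layer and far-field bookkeeping (O(L²) by depth decay t⁻³). The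
interior of A (an on-average two-shell local energy inequality; equality-free certificates; the
steep/Mie ladder as warm-up). The toy rung's minimal-distance lemma (Theil-type removal with core
height 1000). All wait for a crux to move; splits ≤ 3 children, one active decomposition per node.
CHEAPEST FALSIFIER. For B: a certified evaluation of e(hcpStacking a h), e(fccStacking a h) and
e(dhcp) for V = r⁻¹²/12 − r⁻⁶/6 with (a,h)-relaxation to 1e-7 relative, plus the Peierls margin −J_2
− Σ_{k≥3}(k−1)|J_k| > 0 on the relaxation box (card numerics, uncertified: J_2 = −7.2535e−5, J_3 =
−8.5e−8, e_hcp − e_fcc = −7.2e−5; literature: hcp below fcc for (12,6), Stillinger2001,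
BeterminSamajTravenec2022) — a sign flip retargets B to fcc, a vanishing margin kills it. For C:
attempt a 1/20-good non-Barlow configuration by twisting the layering direction across an fcc slab
between two hcp regions (two non-parallel fault planes must meet inside any everywhere-good infinite
configuration — that is the claimed obstruction); note the icosahedral shell is ≥ 0.13 from both
patterns in bottleneck distance (no six icosahedron vertices lie within 3° of a great circle), so
single icosahedral shells are correctly classified as defects at 1/20. For A: common-neighbour
analysis of the largest putative LJ global minima (Cambridge Cluster Database, N ≤ 1610;
decahedral/fcc crossovers) — a non-decaying fraction of non-fcc/hcp signatures in the interior would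
be the warning sign (IcosahedralClusters says finite-N shapes are invisible in Ω, so only interior
FRACTIONS matter).
TWO-LAYER PLAN. Layer 1 (filed now, all typed, Sketch rc = 0): cruxes A, B, C; support D
HullGoodEverywhere, E HullBulkOptimal, F₀ HullDefectDensityZero (real arithmetic), F
HullExactShells, G ExactHcpLocalTheorem, H HullPeriodicCrystallizes, J HullEnergyLowerBound
(bookkeeping from the B-matrix, C, A, D, E and relative denseness), the reused bookkeeping items
CrysEnergyUpper (0629) and CrysPeriodicBddBelow (0714), the rung-0 target T ToyFccCrystallization,
and the Assembly (pure glue + BlancLewin2015_8_holds, hcpPeriodicConfiguration_points, ciInf_le).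
D/E/F are the card's H1/H2 — the same lemmas cards hull-minimality-criterion,
ultrafilter-hull-transfer (H1) and benjamini-schramm-ground-states (A3 = E) ask for: land once.
Recommended first prover items: T (exercises D/F/H-type arguments where A, B, C are trivial:
designed narrow well + repulsive bump at √(8/3) ⟹ fcc, BOTH conjuncts, from flyspeck_L12 +
FejesTothKissingTwelve), then H, F₀, J, E, D. Layer 2: glued splits of B into B1–B3 and of A after
refuter stamps; G may split into ideal-ratio (reduce to HalesDSP_layerPackings_holds + "all shells
anticuboctahedral ⟹ alternating Hägg sequence") and off-ideal (two bond lengths pin the layer plane)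
cases.
NUMBERS. Common tolerance ε₁ = 1/20 (A, B, C); shell cutoff 13/10·d (second shell at √2·d ≈ 1.414d,
2h = 1.633d); icosahedral shell vs cuboctahedron/anticuboctahedron: bottleneck distance ≥ 0.13 on
the unit sphere (jitterbug correspondence moves points by 0.231); hcp box 9/10 < a < 1, |h −
a√(2/3)| ≤ a/100 (LJ: a* ≈ 0.971 r₀, c/a − √(8/3) ≈ 1e−4, Stillinger2001); stacking couplings J_2 ≈
−7.25e−5, J_3 ≈ −8.5e−8 (card, uncertified); toy rung: well [199/200, 201/200] (ratio 1.01005 ≤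
1.01995 of card_le_twelve_of_norm_le), core height 1000, support of V in [0,2], bump at √(8/3) ≈
1.63299 (not an fcc distance; fcc distances √2, √3 < 2).
SOURCES. BlancLewin2015 §1.2–1.3, §2.1–2.3; Radin1991 §2–3; Radin1987; GardnerRadin1979; Hales2012
Thm 1, Lemmas 1–2; HalesDSP2012 §1.3; FlatleyTheil2015 §1, Thm 1.1; Theil2006; HeitmannRadin1980;
AuYeungFrieseckeSchmidt2012; KusnerKusnerLagariasShlosman2018; BoroczkySzabo2016; Stillinger2001;
BeterminSamajTravenec2022; PartayOrtnerCsanyi2017; FrieseckeTheil2002; Xue1997;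
DolbilinLagariasSenechal1998; Levitov 1988 doi:10.1007/bf01218348; KubinPonsiglione2021 (hard
spheres + attractive Riesz tail in the thermodynamic limit — macroscopic, no positional statement);
CrismaleEtAl2023 (failure of crystallization for generalised LJ, d = 1); tree:
CrystallizationLocalLimit.lean, LennardJonesClusters.lean (LennardJonesMinimalDistance_holds,
LennardJonesGroundStatesExist_holds), LennardJonesThermodynamicLimitProofs.lean
(BlancLewin2015_8_holds), LayerStackings.lean (HalesDSP_layerPackings_holds), BarlowStacking.lean
(hcpPeriodicConfiguration), KissingPatterns.lean, FlexibleKissingArrangements.lean.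
DEFINITION REQUESTS. None today: hull membership (two-sided ε-matching along StrictMono φ and
translations τ), pointwise goodness, η-congruence to the hcp shell and the Barlow template are
INLINED so that every item elaborates now (Sketch.lean rc 0). A later refactor may name them
IsLocalLimitOfTranslates (CrystallizationLocalLimit.lean), ShellPatternClose / HcpShellCongruent
(KissingPatterns.lean), BarlowTemplate (BarlowStacking.lean); signatures would then be superseded
1:1.
SUPPORT. D, E, F₀, F, G, H, J, T as above; I₁ = 0629 CrysEnergyUpper and I₂ = 0714
CrysPeriodicBddBelow re-wanted verbatim (they are unclaimed because their only route is blocked;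
this route serves them).
DEGENERATE CASES CHECKED. N = 1 (empty shell ⟹ counted as defect, fraction irrelevant in the limit);
S ∩ B_L(c) = ∅ or a single point in B and E (absorbed by C(L+1)² resp. trivially true); folding of a
template onto itself (excluded by everywhere-goodness: a nearest foreign point would have a closer
template neighbour — covering radius of the (anti)cuboctahedron < 60°); everywhere-good sets with
infinitely many points in a ball (inversion of fcc: excluded by δ-separation, which every hull
element inherits from LennardJonesMinimalDistance_holds); GoodStar with OPEN outer cutoff is closed
under local limits (needed by F); e_∞ as liminf equals the limit (BlancLewin2015_8_holds).

Novelty: Searches run (2026-08-15; searchd DOWN, OpenAlex/S2/arXiv HTTP 429 all session — recorded in NOTES):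
lit frontier AtomisticToContinuum --since 2020 (30 rows, none on LJ crystallization in d = 3);
crossref "Lennard-Jones crystallization three dimensions ground state hcp", "Radin ground state
configurations crystalline order infinite volume" (→ GardnerRadin1979 doi:10.1007/bf01009521),
"Attractive Riesz potentials hard spheres" (→ KubinPonsiglione2021 doi:10.1088/1361-6544/abcb06,
CrismaleEtAl2023 doi:10.1016/j.na.2022.113046), "weak local rules quasicrystals Levitov" (→
doi:10.1007/bf01218348, Socolar doi:10.1007/bf02097107); lit galaxy search "crystallization
conjecture" --star pdf (10 rows: Bétermin 2-D local variational study, Kubin–Ponsiglione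
arXiv:2004.06820, Cohn–Kumar–Miller–Radchenko–Viazovska, Oberwolfach report 49/2018 "Emergence of
Structures in Particle Systems", Cicalese–Kreutz Wulff on FCC/HCP — none states a
hull/exactification route to Blanc–Lewin (16)); the two refuter novelty audits of the card
(refuter-2, refuter-14: Flatley–Theil citation cone walked, 22/65 titles; Kreutz–Ziereis
arXiv:2604.19239 §1 "so far limited to two dimensions"); tree search (lean search) for hull /
local-limit notions: only CrystallizationLocalLimit.lean (matching ⇒ vague convergence), no
orbit-closure or exactification lemma.
Nearest prior art FOUND. (1) Radin's ground-state dynamical system / orbit closure: Radin1991 §2–3,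
Radin1987, GardnerRadin1979 (LJ, d = 1) — the hull languag  [refs: 10.1007/bf01009521, 10.1088/1361-6544/abcb06, 10.1016/j.na.2022.113046, 10.1007/bf01218348, 10.1007/bf02097107, 2004.06820, 2604.19239, doi:10.1007/bf01009521, doi:10.1088/1361-6544/abcb06, doi:10.1016/j.na.2022.113046, doi:10.1007/bf01218348, doi:10.1007/bf02097107, GardnerRadin1979, KubinPonsiglione2021, CrismaleEtAl2023, Radin1991, Radin1987, AuYeungFrieseckeSchmidt2012, Hales2012, HalesDSP2012]

Barriers (technique_class: ground-state-hull; compactness-exactification; kissing-number): - technique_class: ground-state-hull; compactness-exactification; sphere-packing-reduction;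
kissing-number
- Literature.Barriers.AtomisticToContinuum.KissingTwelveDegeneracy: APPLIES to the coordination step
(C/G stop at "Barlow"; its companion fact AperiodicKissingTwelvePackings_holds: every Hägg walk,
aperiodic included, is kissing-twelve — aperiodic stackings are legitimate outputs of C). Evaded by
its evasion (ii): the stacking is selected energetically — crux B prices c-type layers and strain by
a density-proportional gap, exactification F removes them in the hull; in the toy rung T the
repulsive bump AT √(8/3) excludes h-layers exactly.
- Literature.Barriers.AtomisticToContinuum.FlexibleKissingArrangements: APPLIES to inference from
ONE twelve-shell. Evaded: crux A asks the LJ analysis for pattern-closeness directly (not "twelve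
neighbours"); the icosahedral witness is ≥ 0.13 from both patterns in bottleneck distance, so it is
a counted defect at tolerance 1/20; C/G use shells at EVERY point of a hull element (global theorems
after exactification — evasion (i)). Residual: C's tolerance 1/20 is a bet.
- Literature.Barriers.AtomisticToContinuum.FlexibleKissingArrangementsNarrow: not met — no item
infers ShellCloseTo from count-only data (unit vectors, pairwise ≥ 1): A DELIVERS pattern-closeness
as an energetic statement about LJ ground states, C/G CONSUME it at every point; the count-only
single-shell step (0758-type robust Fejes Tóth) is exactly what this route deletes.

Novelty grade: new-combination — ROUTE REVIEW (refuter): URGENT planner edit — Assembly (4879) concludes Literature.MathematicalPhysics.StatisticalMechanics.Crystallization instead of _root_.Crystallization; sibling HullPeriodicPoint was retired today (D-0027 §2.1) for exactly this; defeq abbrev, one-token fix. Otherwise keep open: (refuter refuter-rreview-route-CriticalPhenomena--6f630ba7-0, 2026-08-15T13:52:31Z; prior: Radin1991; BlancLewin2015 §2.1; HalesDSP2012 §1.3; Stillinger2001)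

History (route lifecycle, newest last):
- 2026-08-15T13:43:16Z · CLOSED retired — not-a-thesis: assembly does not conclude the sub-problem Statement (operator:999:1257524)

sub-problem: Crystallization · status: closed(retired) · opened planner-plancard-AtomisticToContinuum-Crystal-79d27627-0 2026-08-15T11:35:26Z · rev 0 · ledger route-AtomisticToContinuum-HullExactification
GENERATED by the gate from the ledger (D-0016/17). Provers cite these decls: `theorem foo : Summit.AtomisticToContinuum.Crystallization.Theses.HullExactification.<Decl> := …` in Summits/AtomisticToContinuum/Crystallization/Theorems/<Name>.lean.
-/

namespace Summit.AtomisticToContinuum.Crystallization.Theses.HullExactification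

open scoped BigOperators Topology Manifold Classical MeasureTheory ProbabilityTheory Matrix InnerProductSpace ComplexConjugate ContinuousMap
open Filter Set Function TopologicalSpace MeasureTheory

attribute [summit_statement] _root_.Crystallization

/-- item stmt-AtomisticToContinuum-4868 · crux · rank 2 · closed · moot by None · by planner
why it might fail: Positive density of polytetrahedral/Frank–Kasper (icosahedral-type) local order in bulk LJ ground states, or no provable on-average two-shell local energy inequality; tolerance 1/20 must also suit C and B.
sources: BlancLewin2015 arXiv:1504.01153 §2.3 ('completely open in dimension three'), FlatleyTheil2015 arXiv:1407.0692 §1, Thm 1.1, Stillinger2001 (LJ hcp vs fcc lattice sums, non-ideal c/a), PartayOrtnerCsanyi2017 arXiv:1705.01751 p.4, Literature.Barriers.AtomisticToContinuum.IcosahedralClusters, Literature.Barriers.AtomisticToContinuum.TetrahedralFrustration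
[crux] (A) ZERO DEFECT DENSITY for Lennard-Jones in ℝ³: for every sequence of ground states x^N, the
fraction of particles i whose first shell {x_j : 0 < |x_j − x_i| < 13/10·d_i} (d_i =
nearest-neighbour distance), rescaled by d_i and recentred, is NOT 1/20-matched (a bijection moving
points ≤ 1/20) after a linear isometry to fccKissingPattern or hcpKissingPattern, tends to 0 as N →
∞ (in particular all but o(N) particles have exactly 12 neighbours below 1.3·d_i and none in
(1.05·d_i, 1.3·d_i)). The tolerance is FIXED (LJ-hcp has c/a ≠ √(8/3), so shells are never exactly
similar to the ideal patterns); no rate, no window matching. Why it might fail: bulk LJ ground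
states could carry a positive density of polytetrahedral / Frank–Kasper local order, and no local
energy inequality seeing two shells is known (TetrahedralFrustration says a one-cell inequality
cannot work). Sources: BlancLewin2015 §2.3; FlatleyTheil2015 §1; Stillinger2001;
PartayOrtnerCsanyi2017; Literature.Barriers.AtomisticToContinuum.IcosahedralClusters; card
hull-exactification-cascade (H3). -/
@[route_item "route-AtomisticToContinuum-HullExactification"]
def ZeroDefectDensity : Prop :=
  ∀ (x : (N : ℕ) → (Fin N → EuclideanSpace ℝ (Fin 3))), (∀ N, Literature.MathematicalPhysics.StatisticalMechanics.IsGroundState Literature.MathematicalPhysics.StatisticalMechanics.lennardJones (x N)) → Filter.Tendsto (fun N : ℕ => (Nat.card {i : Fin N // ¬ (let d : ℝ := sInf ((fun z => dist z (x N i)) '' (Set.range (x N) \ {(x N i)})); let T : Set (EuclideanSpace ℝ (Fin 3)) := {z : EuclideanSpace ℝ (Fin 3) | z ∈ Set.range (x N) ∧ z ≠ (x N i) ∧ dist z (x N i) < 13 / 10 * d}; ∃ A : EuclideanSpace ℝ (Fin 3) →ₗᵢ[ℝ] EuclideanSpace ℝ (Fin 3), (∃ e : ↥T ≃ ↥Literature.Geometry.DiscreteGeometry.fccKissingPattern,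 ∀ t : ↥T, dist (d⁻¹ • ((t : EuclideanSpace ℝ (Fin 3)) - (x N i))) (A ((e t : ↥Literature.Geometry.DiscreteGeometry.fccKissingPattern) : EuclideanSpace ℝ (Fin 3))) ≤ 1 / 20) ∨ (∃ e : ↥T ≃ ↥Literature.Geometry.DiscreteGeometry.hcpKissingPattern, ∀ t : ↥T, dist (d⁻¹ • ((t : EuclideanSpace ℝ (Fin 3)) - (x N i))) (A ((e t : ↥Literature.Geometry.DiscreteGeometry.hcpKissingPattern) : EuclideanSpace ℝ (Fin 3))) ≤ 1 / 20))} : ℝ) / (N : ℝ)) Filter.atTop (nhds (0 : ℝ))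

/-- item stmt-AtomisticToContinuum-4869 · crux · rank 3 · closed · moot by None · by planner
why it might fail: hcp may lose to fcc/polytypes for (12,6)-LJ (margins ~1e-4|e*|, relaxation-sensitive); the Hägg/Peierls gap of 0737 may not survive non-uniform relaxation; needs harmonic stability (no soft modes) with r^-6 tail.
sources: Stillinger2001 (hcp below fcc for LJ; non-ideal c/a), BeterminSamajTravenec2022 arXiv:2107.14020 p.6, PartayOrtnerCsanyi2017 arXiv:1705.01751 p.2,4 (fcc/hcp dispute; polytypes near the boundary), FrieseckeTheil2002 (Cauchy–Born validity/failure, discrete rigidity), stmt-AtomisticToContinuum-0737 HaggDominationAllRanges; stmt-AtomisticToContinuum-0670 certified J_k, Literature.Barriers.AtomisticToContinuum.Hubbard1978_mostHomogeneous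
[crux] (B) HCP LANDSCAPE GAP (density-priced strict minimality of relaxed hcp among perturbed close
packings): there are a*, h* (9/10 < a* < 1, |h* − a*√(2/3)| ≤ a*/100) such that for every δ > 0 and
η > 0 there are κ > 0 and C with: for every δ-separated S ⊆ ℝ³ that is everywhere 1/20-good (as in
A, with S in place of the finite configuration) and has a global Barlow template (as in C), and
every ball B_L(c): 2·e(hcpPeriodicConfiguration a* h*)·#(S∩B_L(c)) + κ·#{y ∈ S∩B_L(c) : the unscaled
shell {z ∈ S : 0 < |z − y| < 1.3a*} is not η-congruent (linear isometry + bijection, displacement ≤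
η) to the shell of hcpStacking a* h* at 0} − C(L+1)² ≤ Σ_{y ∈ S∩B_L(c)} Σ'_{z ∈ S, z ≠ y} V_LJ(|y −
z|). Content: Hägg/Peierls domination with (a,h)- and non-uniform relaxation prices c-type layers
(item 0737 + certified couplings 0670), harmonic + geometric-nonlinear stability of LJ hcp prices
strain (Friesecke–Theil / E–Ming-type discrete Gårding inequality with the r⁻⁶ tail), boundary and
far-field effects are O(L²) by t⁻³ depth decay; everywhere-goodness forbids template folding. Why it
might fail: fcc or a polytype could be the strict minimiser (margins ≈ 1e-4·|e*|; then restate with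
that P), -/
@[route_item "route-AtomisticToContinuum-HullExactification"]
def HcpLandscapeGap : Prop :=
  ∃ a h : ℝ, ∃ ha : a ≠ 0, ∃ hh : h ≠ 0, (9 / 10 < a ∧ a < 1 ∧ |h - a * Real.sqrt (2 / 3)| ≤ a / 100) ∧ (∀ δ : ℝ, 0 < δ → ∀ η : ℝ, 0 < η → ∃ κ : ℝ, 0 < κ ∧ ∃ C : ℝ, ∀ S : Set (EuclideanSpace ℝ (Fin 3)), (∀ y ∈ S, ∀ z ∈ S, y ≠ z → δ ≤ dist y z) → (∀ y ∈ S, (let d : ℝ := sInf ((fun z => dist z y) '' (S \ {y})); let T : Set (EuclideanSpace ℝ (Fin 3)) := {z : EuclideanSpace ℝ (Fin 3) | z ∈ S ∧ z ≠ y ∧ dist z y < 13 / 10 * d}; ∃ A : EuclideanSpace ℝ (Fin 3) →ₗᵢ[ℝ] EuclideanSpace ℝ (Fin 3), (∃ e : ↥T ≃ ↥Literature.Geometry.DiscreteGeometry.fccKissingPattern, ∀ t : ↥T, dist (d⁻¹ • ((t : EuclideanSpace ℝ (Fin 3)) - y)) (A ((e t : ↥Literature.Geometry.DiscreteGeometry.fccKissingPattern)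 : EuclideanSpace ℝ (Fin 3))) ≤ 1 / 20) ∨ (∃ e : ↥T ≃ ↥Literature.Geometry.DiscreteGeometry.hcpKissingPattern, ∀ t : ↥T, dist (d⁻¹ • ((t : EuclideanSpace ℝ (Fin 3)) - y)) (A ((e t : ↥Literature.Geometry.DiscreteGeometry.hcpKissingPattern) : EuclideanSpace ℝ (Fin 3))) ≤ 1 / 20))) → (∃ s : ℤ → ℤ, Literature.MathematicalPhysics.StatisticalMechanics.IsHaggSeq s ∧ ∃ Φ : EuclideanSpace ℝ (Fin 3) → EuclideanSpace ℝ (Fin 3), Set.BijOn Φ (Literature.MathematicalPhysics.StatisticalMechanics.barlowStacking 1 (Real.sqrt (2 / 3)) s) S ∧ ∀ p ∈ Literature.MathematicalPhysics.StatisticalMechanics.barlowStacking 1 (Real.sqrt (2 / 3)) s, ∃ A : EuclideanSpace ℝ (Fin 3) →ₗᵢ[ℝ] EuclideanSpace ℝ (Fin 3), ∃ l : ℝ, 0 < l ∧ ∀ q ∈ Literature.MathematicalPhysics.StatisticalMechanics.barlowStacking 1 (Real.sqrt (2 / 3)) s, dist q p ≤ 1 → dist (Φ q) (Φ p + l • A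 (q - p)) ≤ 1 / 20 * l) → ∀ (c : EuclideanSpace ℝ (Fin 3)) (L : ℝ), 0 ≤ L → 2 * ((Literature.MathematicalPhysics.StatisticalMechanics.hcpPeriodicConfiguration ha hh).energyPerParticle Literature.MathematicalPhysics.StatisticalMechanics.lennardJones) * (({y : EuclideanSpace ℝ (Fin 3) | y ∈ S ∧ dist y c ≤ L} : Set (EuclideanSpace ℝ (Fin 3))).ncard : ℝ) + κ * (({y : EuclideanSpace ℝ (Fin 3) | y ∈ S ∧ dist y c ≤ L ∧ ¬ (let T : Set (EuclideanSpace ℝ (Fin 3)) := {z : EuclideanSpace ℝ (Fin 3) | z ∈ S ∧ z ≠ y ∧ dist z y < 13 / 10 * a}; let P : Set (EuclideanSpace ℝ (Fin 3)) := {p : EuclideanSpace ℝ (Fin 3) | p ∈ Literature.MathematicalPhysics.StatisticalMechanics.hcpStacking a h ∧ p ≠ 0 ∧ ‖p‖ < 13 / 10 * a}; ∃ A : EuclideanSpace ℝ (Fin 3) →ₗᵢ[ℝ] EuclideanSpace ℝ (Fin 3), ∃ e : ↥T ≃ ↥P, ∀ t : ↥T, dist ((t : EuclideanSpace ℝ (Fin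 3)) - y) (A ((e t : ↥P) : EuclideanSpace ℝ (Fin 3))) ≤ η)} : Set (EuclideanSpace ℝ (Fin 3))).ncard : ℝ) - C * (L + 1) ^ 2 ≤ (∑' y : ↥{y : EuclideanSpace ℝ (Fin 3) | y ∈ S ∧ dist y c ≤ L}, (∑' z : ↥{z : EuclideanSpace ℝ (Fin 3) | z ∈ S ∧ z ≠ (y : EuclideanSpace ℝ (Fin 3))}, Literature.MathematicalPhysics.StatisticalMechanics.lennardJones (dist (y : EuclideanSpace ℝ (Fin 3)) (z : EuclideanSpace ℝ (Fin 3))))))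

/-- item stmt-AtomisticToContinuum-4870 · crux · rank 4 · closed · moot by None · by planner
why it might fail: Tolerance 1/20 may be too generous for unambiguous layer propagation (layering direction twisting across fcc-type regions); BoroczkySzabo2016 quasi-12-neighbour constructions / KKLS jitterbug are the threat models.
sources: HalesDSP2012 §1.3 (pp. 12–13); tree HalesDSP_layerPackings_holds (LayerStackings.lean:412), Hales2012 arXiv:1209.6043 Thm 1, Lemma 2, BoroczkySzabo2016 doi:10.1007/s10474-016-0583-4 (acq-00697), KusnerKusnerLagariasShlosman2018 arXiv:1611.10297, DolbilinLagariasSenechal1998 doi:10.1007/PL00009397, Literature.Barriers.AtomisticToContinuum.FlexibleKissingArrangements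
[crux] (C) ROBUST BARLOW TEMPLATE (pure metric geometry, no potential): for every δ > 0, every
nonempty δ-separated S ⊆ ℝ³ all of whose points are 1/20-good (rescaled 13/10·d-shell 1/20-matched
after a linear isometry to the fcc or hcp kissing pattern) is the bijective image Φ(barlowStacking 1
√(2/3) s) of an IDEAL Barlow stacking (IsHaggSeq s) with Φ 1/20-close to a similarity x ↦ Φp +
l_p·A_p(x − p) on every 13-point cluster {q : |q − p| ≤ 1}. This is the robust (ε > 0, ineffective
in nothing but the fixed tolerance) version of the PROVED HalesDSP_layerPackings_holds
(LayerStackings.lean), with the pattern identification supplied as INPUT at every point, so no Fejes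
Tóth / Hales Theorem 1 (exact or robust, cf. 0758) is needed; global consistency uses that an
everywhere-good configuration cannot host two non-parallel fault planes (they would meet) and that
foreign points cannot approach a template (covering radius of the (anti)cuboctahedron). Why it might
fail: 1/20 could be too generous for unambiguous propagation of the layering direction across
fcc-type regions, or δ-uniformity of the constants could fail; ε-quasi-twelve-neighbour
constructions (BoroczkySzabo2016) and the jitte -/
@[route_item "route-AtomisticToContinuum-HullExactification"]
def RobustBarlowTemplate : Prop :=
  ∀ δ : ℝ, 0 < δ → ∀ S : Set (EuclideanSpace ℝ (Fin 3)), S.Nonempty → (∀ y ∈ S, ∀ z ∈ S, y ≠ z → δ ≤ dist y z) → (∀ y ∈ S, (let d : ℝ := sInf ((fun z => dist z y) '' (S \ {y})); let T : Set (EuclideanSpace ℝ (Fin 3)) := {z : EuclideanSpace ℝ (Fin 3) | z ∈ S ∧ z ≠ y ∧ dist z y < 13 / 10 * d}; ∃ A : EuclideanSpace ℝ (Fin 3) →ₗᵢ[ℝ] EuclideanSpace ℝ (Fin 3), (∃ e : ↥T ≃ ↥Literature.Geometry.DiscreteGeometry.fccKissingPattern, ∀ t : ↥T, dist (d⁻¹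 • ((t : EuclideanSpace ℝ (Fin 3)) - y)) (A ((e t : ↥Literature.Geometry.DiscreteGeometry.fccKissingPattern) : EuclideanSpace ℝ (Fin 3))) ≤ 1 / 20) ∨ (∃ e : ↥T ≃ ↥Literature.Geometry.DiscreteGeometry.hcpKissingPattern, ∀ t : ↥T, dist (d⁻¹ • ((t : EuclideanSpace ℝ (Fin 3)) - y)) (A ((e t : ↥Literature.Geometry.DiscreteGeometry.hcpKissingPattern) : EuclideanSpace ℝ (Fin 3))) ≤ 1 / 20))) → (∃ s : ℤ → ℤ, Literature.MathematicalPhysics.StatisticalMechanics.IsHaggSeq s ∧ ∃ Φ : EuclideanSpace ℝ (Fin 3) → EuclideanSpace ℝ (Fin 3), Set.BijOn Φ (Literature.MathematicalPhysics.StatisticalMechanics.barlowStacking 1 (Real.sqrt (2 / 3)) s) S ∧ ∀ p ∈ Literature.MathematicalPhysics.StatisticalMechanics.barlowStacking 1 (Real.sqrt (2 / 3)) s, ∃ A : EuclideanSpace ℝ (Fin 3) →ₗᵢ[ℝ] EuclideanSpace ℝ (Fin 3), ∃ l : ℝ, 0 < l ∧ ∀ q ∈ Literature.MathematicalPhysics.StatisticalMechanics.barlowStacking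 1 (Real.sqrt (2 / 3)) s, dist q p ≤ 1 → dist (Φ q) (Φ p + l • A (q - p)) ≤ 1 / 20 * l)

/-- item stmt-AtomisticToContinuum-0629 · support · rank 9 · closed · moot by None · by planner
Easy half of energetic crystallization: limsup E(N)/N ≤ ⨅ over periodic configurations of the LJ
energy per particle (finite blocks of a near-optimal periodic configuration as trial states;
boundary O(N^{2/3}); r⁻⁶ tail summable in d = 3; needs BddBelow of the range, from LJ stability). -/
@[route_item "route-AtomisticToContinuum-HullExactification"]
def CrysEnergyUpper : Prop :=
  Filter.limsup (fun N : ℕ => Literature.MathematicalPhysics.StatisticalMechanics.groundStateEnergy Literature.MathematicalPhysics.StatisticalMechanics.lennardJones 3 N / N) Filter.atTop ≤ ⨅ Q : Literature.MathematicalPhysics.StatisticalMechanics.PeriodicConfiguration 3, Q.energyPerParticle Literature.MathematicalPhysics.StatisticalMechanics.lennardJones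

/-- item stmt-AtomisticToContinuum-0714 · support · rank 9 · closed · proved by Summit.AtomisticToContinuum.Crystallization.Theorems.crysPeriodicBddBelow_proof (prover) · by planner
The Lennard-Jones energy per particle of periodic configurations of ℝ³ (any full-rank lattice, any
finite motif) is bounded below (by −B, the stability constant: finite blocks of Q as N-point
configurations, boundary O(N^{2/3}), r⁻⁶ tail summable in d = 3). Makes ⨅_Q e(Q) a genuine infimum
(ciInf_le usable) in 0626/0629 and in the periodisation lemma. -/
@[route_item "route-AtomisticToContinuum-HullExactification"]
def CrysPeriodicBddBelow : Prop :=
  BddBelow (Set.range fun Q : Literature.MathematicalPhysics.StatisticalMechanics.PeriodicConfiguration 3 => Q.energyPerParticle Literature.MathematicalPhysics.StatisticalMechanics.lennardJones)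

/-- item stmt-AtomisticToContinuum-4871 · support · rank 9 · closed · moot by None · by planner
[support] (D) EXACTIFICATION no. 1 (card H1): for a sequence of LJ ground states whose 1/20-defect
fraction tends to 0 (the conclusion of A for this x), there is a hull element S — a local limit, in
the two-sided ε-matching sense on balls ‖·‖ ≤ R (exactly the hypothesis shape of
CrystallizationLocalLimit.tendsto_sum_of_eventually_near'), of translates x^{φ(j)} + τ_j along a
StrictMono φ — which is δ-separated (δ from LennardJonesMinimalDistance_holds), contains 0, is
EVERYWHERE 1/20-good, and is relatively dense (every R₁-ball meets S). Proof sketch: pigeonhole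
gives particles whose R_j-ball (R_j → ∞) is defect-free; recentre there; Hausdorff-type compactness
of δ-separated sets + diagonal extraction; goodness (open outer cutoff 13/10·d, closed matching ≤
1/20) passes to local limits; no isolated particles in ground states (relocation to the surface
gains ≥ 1/12) bounds the local scale, and full shells in all directions give relative denseness.
Shared with cards hull-minimality-criterion / ultrafilter-hull-transfer. -/
@[route_item "route-AtomisticToContinuum-HullExactification"]
def HullGoodEverywhere : Prop :=
  ∀ (x : (N : ℕ) → (Fin N → EuclideanSpace ℝ (Fin 3))), (∀ N, Literature.MathematicalPhysics.StatisticalMechanics.IsGroundState Literature.MathematicalPhysics.StatisticalMechanics.lennardJones (x N)) → Filter.Tendsto (fun N : ℕ => (Nat.card {i : Fin N // ¬ (let d : ℝ := sInf ((fun z => dist z (x N i)) '' (Set.range (x N) \ {(x N i)})); let T : Set (EuclideanSpace ℝ (Fin 3)) := {z : EuclideanSpace ℝ (Fin 3) | z ∈ Set.range (x N) ∧ z ≠ (x N i) ∧ dist z (x N i) < 13 / 10 * d}; ∃ A : EuclideanSpace ℝ (Fin 3) →ₗᵢ[ℝ] EuclideanSpace ℝ (Fin 3), (∃ e : ↥T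 ≃ ↥Literature.Geometry.DiscreteGeometry.fccKissingPattern, ∀ t : ↥T, dist (d⁻¹ • ((t : EuclideanSpace ℝ (Fin 3)) - (x N i))) (A ((e t : ↥Literature.Geometry.DiscreteGeometry.fccKissingPattern) : EuclideanSpace ℝ (Fin 3))) ≤ 1 / 20) ∨ (∃ e : ↥T ≃ ↥Literature.Geometry.DiscreteGeometry.hcpKissingPattern, ∀ t : ↥T, dist (d⁻¹ • ((t : EuclideanSpace ℝ (Fin 3)) - (x N i))) (A ((e t : ↥Literature.Geometry.DiscreteGeometry.hcpKissingPattern) : EuclideanSpace ℝ (Fin 3))) ≤ 1 / 20))} : ℝ) / (N : ℝ)) Filter.atTop (nhds (0 : ℝ)) → ∃ S : Set (EuclideanSpace ℝ (Fin 3)), ∃ δ : ℝ, 0 < δ ∧ (∀ y ∈ S, ∀ z ∈ S, y ≠ z → δ ≤ dist y z) ∧ (0 : EuclideanSpace ℝ (Fin 3)) ∈ S ∧ (∃ φ : ℕ → ℕ, StrictMono φ ∧ ∃ τ : ℕ → EuclideanSpace ℝ (Fin 3), (∀ R ε : ℝ, 0 < ε → ∀ᶠ j : ℕ in Filter.atTop,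 (∀ s ∈ S, ‖s‖ ≤ R → ∃ i : Fin (φ j), dist (x (φ j) i + τ j) s ≤ ε) ∧ (∀ i : Fin (φ j), ‖x (φ j) i + τ j‖ ≤ R → ∃ s ∈ S, dist (x (φ j) i + τ j) s ≤ ε))) ∧ (∀ y ∈ S, (let d : ℝ := sInf ((fun z => dist z y) '' (S \ {y})); let T : Set (EuclideanSpace ℝ (Fin 3)) := {z : EuclideanSpace ℝ (Fin 3) | z ∈ S ∧ z ≠ y ∧ dist z y < 13 / 10 * d}; ∃ A : EuclideanSpace ℝ (Fin 3) →ₗᵢ[ℝ] EuclideanSpace ℝ (Fin 3), (∃ e : ↥T ≃ ↥Literature.Geometry.DiscreteGeometry.fccKissingPattern, ∀ t : ↥T, dist (d⁻¹ • ((t : EuclideanSpace ℝ (Fin 3)) - y)) (A ((e t : ↥Literature.Geometry.DiscreteGeometry.fccKissingPattern) : EuclideanSpace ℝ (Fin 3))) ≤ 1 / 20) ∨ (∃ e : ↥T ≃ ↥Literature.Geometry.DiscreteGeometry.hcpKissingPattern, ∀ t : ↥T, dist (d⁻¹ • ((t : EuclideanSpace ℝ (Fin 3)) - y)) (A ((e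 t : ↥Literature.Geometry.DiscreteGeometry.hcpKissingPattern) : EuclideanSpace ℝ (Fin 3))) ≤ 1 / 20))) ∧ (∃ R₁ : ℝ, ∀ p : EuclideanSpace ℝ (Fin 3), ∃ y ∈ S, dist y p ≤ R₁)

/-- item stmt-AtomisticToContinuum-4872 · support · rank 9 · closed · moot by None · by planner
[support] (E) BULK OPTIMALITY OF HULL ELEMENTS (card H2 = surgery lemma A3 of card
benjamini-schramm-ground-states): for LJ ground states x and every δ-separated hull element S of x:
∀ ε > 0 ∃ L₀ ∀ L ≥ L₀ ∀ c, Σ_{y ∈ S∩B_L(c)} Σ'_{z∈S, z≠y} V_LJ(|y−z|) ≤ 2·e_∞·#(S∩B_L(c)) + εL³ with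
e_∞ = liminf_N E(N)/N (= lim, BlancLewin2015_8_holds). Proof sketch (cut-and-paste): otherwise
remove the ≈ n particles of x^{φ(j)} near c − τ_j (energy drop Σ siteE − E_self = ½Σ siteE +
½·cross, cross ≥ −C_δ L²), re-insert them far away as an optimal n-cluster (E(n) ≤ n·e_∞ + o(n)) at
distance ≥ 1 from everything (interaction ≤ 0): the energy decreases — contradiction; tails beyond
the matching radius are O(n·(L''−L)⁻³) by δ-separation and r⁻⁶. -/
@[route_item "route-AtomisticToContinuum-HullExactification"]
def HullBulkOptimal : Prop :=
  ∀ (x : (N : ℕ) → (Fin N → EuclideanSpace ℝ (Fin 3))), (∀ N, Literature.MathematicalPhysics.StatisticalMechanics.IsGroundState Literature.MathematicalPhysics.StatisticalMechanics.lennardJones (x N)) → ∀ (S : Set (EuclideanSpace ℝ (Fin 3))) (δ : ℝ), 0 < δ → (∀ y ∈ S, ∀ z ∈ S, y ≠ z → δ ≤ dist y z) → (∃ φ : ℕ → ℕ, StrictMono φ ∧ ∃ τ : ℕ → EuclideanSpace ℝ (Fin 3), (∀ R ε : ℝ, 0 < ε → ∀ᶠ j : ℕ in Filter.atTop, (∀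 s ∈ S, ‖s‖ ≤ R → ∃ i : Fin (φ j), dist (x (φ j) i + τ j) s ≤ ε) ∧ (∀ i : Fin (φ j), ‖x (φ j) i + τ j‖ ≤ R → ∃ s ∈ S, dist (x (φ j) i + τ j) s ≤ ε))) → ∀ ε : ℝ, 0 < ε → ∃ L₀ : ℝ, ∀ L : ℝ, L₀ ≤ L → ∀ c : EuclideanSpace ℝ (Fin 3), (∑' y : ↥{y : EuclideanSpace ℝ (Fin 3) | y ∈ S ∧ dist y c ≤ L}, (∑' z : ↥{z : EuclideanSpace ℝ (Fin 3) | z ∈ S ∧ z ≠ (y : EuclideanSpace ℝ (Fin 3))}, Literature.MathematicalPhysics.StatisticalMechanics.lennardJones (dist (y : EuclideanSpace ℝ (Fin 3)) (z : EuclideanSpace ℝ (Fin 3))))) ≤ 2 * (Filter.liminf (fun N : ℕ => Literature.MathematicalPhysics.StatisticalMechanics.groundStateEnergy Literature.MathematicalPhysics.StatisticalMechanics.lennardJones 3 N / (N : ℝ)) Filter.atTop) * (({y : EuclideanSpace ℝ (Fin 3) | y ∈ S ∧ dist y c ≤ L} : Set (EuclideanSpace ℝ (Fin 3))).ncard : ℝ)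 + ε * L ^ 3

/-- item stmt-AtomisticToContinuum-4873 · support · rank 9 · closed · moot by None · by planner
[support] (F₀) ARITHMETIC: for fixed a, h, S, the B-inequality for S (∀ η ∃ κ>0, C ∀ c L: 2e*·n +
κ·#bad_η − C(L+1)² ≤ Σ siteE), the E-inequality for S (∀ ε ∃ L₀ ∀ L ≥ L₀ ∀ c: Σ siteE ≤ 2e_∞·n +
εL³) and e_∞ ≤ e* give: ∀ η > 0 ∀ θ > 0 ∃ L₀ ∀ L ≥ L₀ ∀ c, #bad_η(S∩B_L(c)) ≤ θL³ (take ε = κθ/2; n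
≥ 0). Pure real-number bookkeeping; provable now. -/
@[route_item "route-AtomisticToContinuum-HullExactification"]
def HullDefectDensityZero : Prop :=
  ∀ a h : ℝ, ∀ ha : a ≠ 0, ∀ hh : h ≠ 0, ∀ S : Set (EuclideanSpace ℝ (Fin 3)), (∀ η : ℝ, 0 < η → ∃ κ : ℝ, 0 < κ ∧ ∃ C : ℝ, ∀ (c : EuclideanSpace ℝ (Fin 3)) (L : ℝ), 0 ≤ L → 2 * ((Literature.MathematicalPhysics.StatisticalMechanics.hcpPeriodicConfiguration ha hh).energyPerParticle Literature.MathematicalPhysics.StatisticalMechanics.lennardJones) * (({y : EuclideanSpace ℝ (Fin 3) | y ∈ S ∧ dist y c ≤ L} : Set (EuclideanSpace ℝ (Fin 3))).ncard : ℝ) + κ * (({y : EuclideanSpace ℝ (Fin 3) | y ∈ S ∧ dist y c ≤ L ∧ ¬ (let T : Set (EuclideanSpace ℝ (Fin 3)) := {z : EuclideanSpace ℝ (Fin 3) | z ∈ S ∧ z ≠ y ∧ dist z y < 13 / 10 * a}; let P : Set (EuclideanSpace ℝ (Fin 3)) := {p : EuclideanSpace ℝ (Fin 3) | p ∈ Literature.MathematicalPhysics.StatisticalMechanics.hcpStacking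 a h ∧ p ≠ 0 ∧ ‖p‖ < 13 / 10 * a}; ∃ A : EuclideanSpace ℝ (Fin 3) →ₗᵢ[ℝ] EuclideanSpace ℝ (Fin 3), ∃ e : ↥T ≃ ↥P, ∀ t : ↥T, dist ((t : EuclideanSpace ℝ (Fin 3)) - y) (A ((e t : ↥P) : EuclideanSpace ℝ (Fin 3))) ≤ η)} : Set (EuclideanSpace ℝ (Fin 3))).ncard : ℝ) - C * (L + 1) ^ 2 ≤ (∑' y : ↥{y : EuclideanSpace ℝ (Fin 3) | y ∈ S ∧ dist y c ≤ L}, (∑' z : ↥{z : EuclideanSpace ℝ (Fin 3) | z ∈ S ∧ z ≠ (y : EuclideanSpace ℝ (Fin 3))}, Literature.MathematicalPhysics.StatisticalMechanics.lennardJones (dist (y : EuclideanSpace ℝ (Fin 3)) (z : EuclideanSpace ℝ (Fin 3)))))) → (∀ ε : ℝ, 0 < ε → ∃ L₀ : ℝ, ∀ L : ℝ, L₀ ≤ L → ∀ c : EuclideanSpace ℝ (Fin 3), (∑' y : ↥{y : EuclideanSpace ℝ (Fin 3) | y ∈ S ∧ dist y c ≤ L}, (∑' z : ↥{z : EuclideanSpace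 ℝ (Fin 3) | z ∈ S ∧ z ≠ (y : EuclideanSpace ℝ (Fin 3))}, Literature.MathematicalPhysics.StatisticalMechanics.lennardJones (dist (y : EuclideanSpace ℝ (Fin 3)) (z : EuclideanSpace ℝ (Fin 3))))) ≤ 2 * (Filter.liminf (fun N : ℕ => Literature.MathematicalPhysics.StatisticalMechanics.groundStateEnergy Literature.MathematicalPhysics.StatisticalMechanics.lennardJones 3 N / (N : ℝ)) Filter.atTop) * (({y : EuclideanSpace ℝ (Fin 3) | y ∈ S ∧ dist y c ≤ L} : Set (EuclideanSpace ℝ (Fin 3))).ncard : ℝ) + ε * L ^ 3) → (Filter.liminf (fun N : ℕ => Literature.MathematicalPhysics.StatisticalMechanics.groundStateEnergy Literature.MathematicalPhysics.StatisticalMechanics.lennardJones 3 N / (N : ℝ)) Filter.atTop) ≤ ((Literature.MathematicalPhysics.StatisticalMechanics.hcpPeriodicConfiguration ha hh).energyPerParticle Literature.MathematicalPhysics.StatisticalMechanics.lennardJones) → (∀ η : ℝ, 0 < η → ∀ θ : ℝ, 0 < θ → ∃ L₀ : ℝ, ∀ L : ℝ, L₀ ≤ L → ∀ c : EuclideanSpace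 ℝ (Fin 3), (({y : EuclideanSpace ℝ (Fin 3) | y ∈ S ∧ dist y c ≤ L ∧ ¬ (let T : Set (EuclideanSpace ℝ (Fin 3)) := {z : EuclideanSpace ℝ (Fin 3) | z ∈ S ∧ z ≠ y ∧ dist z y < 13 / 10 * a}; let P : Set (EuclideanSpace ℝ (Fin 3)) := {p : EuclideanSpace ℝ (Fin 3) | p ∈ Literature.MathematicalPhysics.StatisticalMechanics.hcpStacking a h ∧ p ≠ 0 ∧ ‖p‖ < 13 / 10 * a}; ∃ A : EuclideanSpace ℝ (Fin 3) →ₗᵢ[ℝ] EuclideanSpace ℝ (Fin 3), ∃ e : ↥T ≃ ↥P, ∀ t : ↥T, dist ((t : EuclideanSpace ℝ (Fin 3)) - y) (A ((e t : ↥P) : EuclideanSpace ℝ (Fin 3))) ≤ η)} : Set (EuclideanSpace ℝ (Fin 3))).ncard : ℝ) ≤ θ * L ^ 3)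

/-- item stmt-AtomisticToContinuum-4874 · support · rank 9 · closed · moot by None · by planner
[support] (F) EXACTIFICATION no. 2 (inside the hull; card H1 again): if a δ-separated, relatively
dense hull element S of the LJ ground states x has, for every η > 0, η-bad points (unscaled
1.3a-shell not η-congruent to the hcp(a,h) shell at 0) of density zero uniformly over balls
(#bad_η(S∩B_L(c)) ≤ θL³ for L ≥ L₀(η,θ)), then some hull element S₂ of x is δ-separated, contains 0
and has EVERY point η-good for EVERY η > 0 (hence, G, exactly hcp). Proof sketch: grid/pigeonhole
gives η_k-bad-free balls B_{L_k}(y_k), y_k ∈ S, L_k → ∞, η_k → 0; translates of hull elements are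
hull elements; a local limit of S − y_k exists (compactness of δ-separated sets) and lies in the
hull (limits of limits: diagonal argument); η-goodness (open outer cutoff, closed matching) passes
to local limits and is monotone in η. -/
@[route_item "route-AtomisticToContinuum-HullExactification"]
def HullExactShells : Prop :=
  ∀ (x : (N : ℕ) → (Fin N → EuclideanSpace ℝ (Fin 3))), (∀ N, Literature.MathematicalPhysics.StatisticalMechanics.IsGroundState Literature.MathematicalPhysics.StatisticalMechanics.lennardJones (x N)) → ∀ (a h : ℝ) (S : Set (EuclideanSpace ℝ (Fin 3))) (δ : ℝ), 0 < δ → 0 < a → (∀ y ∈ S, ∀ z ∈ S, y ≠ z → δ ≤ dist y z) → (∃ φ : ℕ → ℕ, StrictMono φ ∧ ∃ τ : ℕ → EuclideanSpace ℝ (Fin 3), (∀ R ε : ℝ, 0 < ε → ∀ᶠ j : ℕ in Filter.atTop, (∀ s ∈ S, ‖s‖ ≤ R → ∃ i : Fin (φ j), dist (x (φ j) i + τ j) s ≤ ε) ∧ (∀ i : Fin (φ j), ‖x (φ j) i + τ j‖ ≤ R → ∃ s ∈ S, dist (x (φ j) i + τ j) s ≤ ε))) → (∃ R₁ : ℝ,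 ∀ p : EuclideanSpace ℝ (Fin 3), ∃ y ∈ S, dist y p ≤ R₁) → (∀ η : ℝ, 0 < η → ∀ θ : ℝ, 0 < θ → ∃ L₀ : ℝ, ∀ L : ℝ, L₀ ≤ L → ∀ c : EuclideanSpace ℝ (Fin 3), (({y : EuclideanSpace ℝ (Fin 3) | y ∈ S ∧ dist y c ≤ L ∧ ¬ (let T : Set (EuclideanSpace ℝ (Fin 3)) := {z : EuclideanSpace ℝ (Fin 3) | z ∈ S ∧ z ≠ y ∧ dist z y < 13 / 10 * a}; let P : Set (EuclideanSpace ℝ (Fin 3)) := {p : EuclideanSpace ℝ (Fin 3) | p ∈ Literature.MathematicalPhysics.StatisticalMechanics.hcpStacking a h ∧ p ≠ 0 ∧ ‖p‖ < 13 / 10 * a}; ∃ A : EuclideanSpace ℝ (Fin 3) →ₗᵢ[ℝ] EuclideanSpace ℝ (Fin 3), ∃ e : ↥T ≃ ↥P, ∀ t : ↥T, dist ((t : EuclideanSpace ℝ (Fin 3)) - y) (A ((e t : ↥P) : EuclideanSpace ℝ (Fin 3))) ≤ η)} : Set (EuclideanSpace ℝ (Fin 3))).ncard : ℝ) ≤ θ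 * L ^ 3) → ∃ S₂ : Set (EuclideanSpace ℝ (Fin 3)), (∀ y ∈ S₂, ∀ z ∈ S₂, y ≠ z → δ ≤ dist y z) ∧ (0 : EuclideanSpace ℝ (Fin 3)) ∈ S₂ ∧ (∃ φ : ℕ → ℕ, StrictMono φ ∧ ∃ τ : ℕ → EuclideanSpace ℝ (Fin 3), (∀ R ε : ℝ, 0 < ε → ∀ᶠ j : ℕ in Filter.atTop, (∀ s ∈ S₂, ‖s‖ ≤ R → ∃ i : Fin (φ j), dist (x (φ j) i + τ j) s ≤ ε) ∧ (∀ i : Fin (φ j), ‖x (φ j) i + τ j‖ ≤ R → ∃ s ∈ S₂, dist (x (φ j) i + τ j) s ≤ ε))) ∧ ∀ y ∈ S₂, ∀ η : ℝ, 0 < η → (let T : Set (EuclideanSpace ℝ (Fin 3)) := {z : EuclideanSpace ℝ (Fin 3) | z ∈ S₂ ∧ z ≠ y ∧ dist z y < 13 / 10 * a}; let P : Set (EuclideanSpace ℝ (Fin 3)) := {p : EuclideanSpace ℝ (Fin 3) | p ∈ Literature.MathematicalPhysics.StatisticalMechanics.hcpStacking a h ∧ p ≠ 0 ∧ ‖p‖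 < 13 / 10 * a}; ∃ A : EuclideanSpace ℝ (Fin 3) →ₗᵢ[ℝ] EuclideanSpace ℝ (Fin 3), ∃ e : ↥T ≃ ↥P, ∀ t : ↥T, dist ((t : EuclideanSpace ℝ (Fin 3)) - y) (A ((e t : ↥P) : EuclideanSpace ℝ (Fin 3))) ≤ η)

/-- item stmt-AtomisticToContinuum-4875 · support · rank 9 · closed · moot by None · by planner
[support] (G) EXACT (η = 0) HCP LOCAL THEOREM, valid OFF the ideal ratio: for 9/10 < a < 1, |h −
a√(2/3)| ≤ a/100, a nonempty S ⊆ ℝ³ in which every point's 1.3a-shell is, for every η > 0,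
η-congruent to the 12-point shell of hcpStacking a h at 0 (so exactly congruent, by compactness of
O(3) and finiteness of bijections) is g(hcpStacking a h) for an isometry g. Ideal ratio: S/a·2 is a
unit-ball packing with all tangent arrangements the HCP pattern ⟹ HalesDSP_layerPackings_holds gives
a Barlow stacking, all layers h-type ⟹ Hägg sequence alternating ⟹ hcp up to isometry. Off-ideal:
the shell has 6 points at a (hexagon) and 6 at √(a²/3 + h²) ≠ a, so the hexagon plane propagates to
in-plane neighbours (3 shared non-collinear points) ⟹ global layers, triangular, adjacent layers in
aligned-triangle position ⟹ hcp. The card's 'η = 0 local theorem that survives c/a ≠ √(8/3)' (cf.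
card barlow-family-exact-propagation, simplest member). -/
@[route_item "route-AtomisticToContinuum-HullExactification"]
def ExactHcpLocalTheorem : Prop :=
  ∀ a h : ℝ, (9 / 10 < a ∧ a < 1 ∧ |h - a * Real.sqrt (2 / 3)| ≤ a / 100) → ∀ S : Set (EuclideanSpace ℝ (Fin 3)), S.Nonempty → (∀ y ∈ S, ∀ η : ℝ, 0 < η → (let T : Set (EuclideanSpace ℝ (Fin 3)) := {z : EuclideanSpace ℝ (Fin 3) | z ∈ S ∧ z ≠ y ∧ dist z y < 13 / 10 * a}; let P : Set (EuclideanSpace ℝ (Fin 3)) := {p : EuclideanSpace ℝ (Fin 3) | p ∈ Literature.MathematicalPhysics.StatisticalMechanics.hcpStacking a h ∧ p ≠ 0 ∧ ‖p‖ < 13 / 10 * a}; ∃ A : EuclideanSpace ℝ (Fin 3) →ₗᵢ[ℝ] EuclideanSpace ℝ (Fin 3), ∃ e : ↥T ≃ ↥P, ∀ t : ↥T, dist ((t : EuclideanSpace ℝ (Fin 3)) - y) (A ((e t : ↥P) : EuclideanSpace ℝ (Fin 3))) ≤ η)) → ∃ g : EuclideanSpace ℝ (Fin 3) ≃ᵢ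 EuclideanSpace ℝ (Fin 3), S = g '' Literature.MathematicalPhysics.StatisticalMechanics.hcpStacking a h

/-- item stmt-AtomisticToContinuum-4876 · support · rank 9 · closed · moot by None · by planner
[support] (H) A PERIODIC POINT SET IN THE HULL GIVES BLANC–LEWIN (16): if some hull element of the
LJ ground states x is g(P.points) for a PeriodicConfiguration P and an isometry g, then the
IsCrystallizing clause holds for x (multiplicity m ≡ 1). Proof: g(P.points) =
(isometryImage/translate of P).points (CrystallizationSymmetries.lean);
LennardJonesMinimalDistance_holds gives the separation hypothesis and the matching is literally
hypothesis h of PeriodicConfiguration.tendsto_sum_of_eventually_near'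
(CrystallizationLocalLimit.lean). Provable now. -/
@[route_item "route-AtomisticToContinuum-HullExactification"]
def HullPeriodicCrystallizes : Prop :=
  ∀ (x : (N : ℕ) → (Fin N → EuclideanSpace ℝ (Fin 3))), (∀ N, Literature.MathematicalPhysics.StatisticalMechanics.IsGroundState Literature.MathematicalPhysics.StatisticalMechanics.lennardJones (x N)) → (∃ (P : Literature.MathematicalPhysics.StatisticalMechanics.PeriodicConfiguration 3) (g : EuclideanSpace ℝ (Fin 3) ≃ᵢ EuclideanSpace ℝ (Fin 3)), (∃ φ : ℕ → ℕ, StrictMono φ ∧ ∃ τ : ℕ → EuclideanSpace ℝ (Fin 3), (∀ R ε : ℝ, 0 < ε → ∀ᶠ j : ℕ in Filter.atTop, (∀ s ∈ (g '' P.points), ‖s‖ ≤ R → ∃ i : Fin (φ j), dist (x (φ j) i + τ j) s ≤ ε) ∧ (∀ i : Fin (φ j), ‖x (φ j) i + τ j‖ ≤ R → ∃ s ∈ (g '' P.points), dist (x (φ j) i + τ j) s ≤ ε)))) → ∃ (φ : ℕ → ℕ) (τ : ℕ → EuclideanSpace ℝ (Fin 3)) (P : Literature.MathematicalPhysics.StatisticalMechanics.PeriodicConfiguration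 3) (m : EuclideanSpace ℝ (Fin 3) → ℕ), StrictMono φ ∧ (∀ s ∈ P.points, 1 ≤ m s) ∧ (∀ g ∈ P.lattice, ∀ s, m (s + g) = m s) ∧ ∀ f : EuclideanSpace ℝ (Fin 3) → ℝ, Continuous f → HasCompactSupport f → Filter.Tendsto (fun j => ∑ i : Fin (φ j), f (x (φ j) i + τ j)) Filter.atTop (nhds (∑' s : P.points, (m s : ℝ) * f s))

/-- item stmt-AtomisticToContinuum-4877 · support · rank 9 · closed · moot by None · by planner
[support] (J) CONJUNCT (i) FROM THE HULL: for a, h in the box, the B-matrix at (a,h) (the body of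
HcpLandscapeGap), C, A, D and E imply e(hcpPeriodicConfiguration a h) ≤ liminf E(N)/N. Proof
(bookkeeping): LennardJonesGroundStatesExist_holds gives a ground-state sequence x; D gives a hull
element S₁ ∋ 0, δ-separated, everywhere good, R₁-dense; C gives the template; B at η = 1 with the
κ-term dropped: 2e*·n − C(L+1)² ≤ Σ_{S₁∩B_L(0)} siteE; E: Σ ≤ 2e_∞·n + εL³; R₁-denseness gives n ≥
c·L³ (disjoint R₁-balls), so e* − e_∞ ≤ (C(L+1)² + εL³)/(2cL³) → ε/2c → 0. -/
@[route_item "route-AtomisticToContinuum-HullExactification"]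
def HullEnergyLowerBound : Prop :=
  ∀ a h : ℝ, ∀ ha : a ≠ 0, ∀ hh : h ≠ 0, ∀ (S : Set (EuclideanSpace ℝ (Fin 3))) (δ : ℝ), 0 < δ → (∀ y ∈ S, ∀ z ∈ S, y ≠ z → δ ≤ dist y z) → (∃ R₁ : ℝ, ∀ p : EuclideanSpace ℝ (Fin 3), ∃ y ∈ S, dist y p ≤ R₁) → (∀ η : ℝ, 0 < η → ∃ κ : ℝ, 0 < κ ∧ ∃ C : ℝ, ∀ (c : EuclideanSpace ℝ (Fin 3)) (L : ℝ), 0 ≤ L → 2 * ((Literature.MathematicalPhysics.StatisticalMechanics.hcpPeriodicConfiguration ha hh).energyPerParticle Literature.MathematicalPhysics.StatisticalMechanics.lennardJones) * (({y : EuclideanSpace ℝ (Fin 3) | y ∈ S ∧ dist y c ≤ L} : Set (EuclideanSpace ℝ (Fin 3))).ncard : ℝ) + κ * (({y : EuclideanSpace ℝ (Fin 3) | y ∈ S ∧ dist y c ≤ L ∧ ¬ (let T : Set (EuclideanSpace ℝ (Fin 3)) := {z : EuclideanSpace ℝ (Fin 3) | z ∈ S ∧ z ≠ y ∧ dist z y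 < 13 / 10 * a}; let P : Set (EuclideanSpace ℝ (Fin 3)) := {p : EuclideanSpace ℝ (Fin 3) | p ∈ Literature.MathematicalPhysics.StatisticalMechanics.hcpStacking a h ∧ p ≠ 0 ∧ ‖p‖ < 13 / 10 * a}; ∃ A : EuclideanSpace ℝ (Fin 3) →ₗᵢ[ℝ] EuclideanSpace ℝ (Fin 3), ∃ e : ↥T ≃ ↥P, ∀ t : ↥T, dist ((t : EuclideanSpace ℝ (Fin 3)) - y) (A ((e t : ↥P) : EuclideanSpace ℝ (Fin 3))) ≤ η)} : Set (EuclideanSpace ℝ (Fin 3))).ncard : ℝ) - C * (L + 1) ^ 2 ≤ (∑' y : ↥{y : EuclideanSpace ℝ (Fin 3) | y ∈ S ∧ dist y c ≤ L}, (∑' z : ↥{z : EuclideanSpace ℝ (Fin 3) | z ∈ S ∧ z ≠ (y : EuclideanSpace ℝ (Fin 3))}, Literature.MathematicalPhysics.StatisticalMechanics.lennardJones (dist (y : EuclideanSpace ℝ (Fin 3)) (z : EuclideanSpace ℝ (Fin 3)))))) → (∀ ε : ℝ, 0 < ε → ∃ L₀ : ℝ, ∀ L : ℝ, L₀ ≤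 L → ∀ c : EuclideanSpace ℝ (Fin 3), (∑' y : ↥{y : EuclideanSpace ℝ (Fin 3) | y ∈ S ∧ dist y c ≤ L}, (∑' z : ↥{z : EuclideanSpace ℝ (Fin 3) | z ∈ S ∧ z ≠ (y : EuclideanSpace ℝ (Fin 3))}, Literature.MathematicalPhysics.StatisticalMechanics.lennardJones (dist (y : EuclideanSpace ℝ (Fin 3)) (z : EuclideanSpace ℝ (Fin 3))))) ≤ 2 * (Filter.liminf (fun N : ℕ => Literature.MathematicalPhysics.StatisticalMechanics.groundStateEnergy Literature.MathematicalPhysics.StatisticalMechanics.lennardJones 3 N / (N : ℝ)) Filter.atTop) * (({y : EuclideanSpace ℝ (Fin 3) | y ∈ S ∧ dist y c ≤ L} : Set (EuclideanSpace ℝ (Fin 3))).ncard : ℝ) + ε * L ^ 3) → ((Literature.MathematicalPhysics.StatisticalMechanics.hcpPeriodicConfiguration ha hh).energyPerParticle Literature.MathematicalPhysics.StatisticalMechanics.lennardJones) ≤ (Filter.liminf (fun N : ℕ => Literature.MathematicalPhysics.StatisticalMechanics.groundStateEnergy Literature.MathematicalPhysics.StatisticalMechanics.lennardJones 3 N / (N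 : ℝ)) Filter.atTop)

/-- item stmt-AtomisticToContinuum-4878 · support · rank 9 · closed · moot by None · by planner
[support] (T) RUNG 0 — THE TOY FCC THEOREM (card H6; first pure isotropic pair potential with BOTH
Blanc–Lewin conjuncts in ℝ³, designed, weak form; recommended first prover target, it debugs D/F/H
where A, B, C are trivial): assume flyspeck_L12 and FejesTothKissingTwelve (named facts; the latter
follows from flyspeck_L12 + Hales2012_contactGraphTame in the tree). Let V : ℝ → ℝ with core V ≥
1000 on (0, 199/200], V ≥ −1 everywhere, V(1) = −1 with uniform strictness (∀ η ∃ θ > 0: |r − 1| ≥ η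
⟹ V(r) ≥ θ − 1), V ≥ 0 on [201/200, ∞), V(√2) = V(√3) = 0, V = 0 on [2, ∞), and a bump V ≥ β > 0 on
[√(8/3) − β, √(8/3) + β]. Then HasPeriodicGroundStateEnergy V 3 ∧ IsCrystallizing V 3 (limit fcc
with nearest-neighbour distance 1, e = −6). Chain: bonds (pairs in the well [199/200, 201/200])
number ≤ 6N up to core-pair corrections paid by the core height (card_le_twelve_of_norm_le with
ratio 1.01005 ≤ 1.01995; Theil-type removal if a per-particle bound is wanted), E(fcc block) ≤ −6N +
CN^{2/3} ⟹ every defect count (under-coordination, |r − 1| ≥ η bonds, core pairs, pairs near √(8/3))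
is O_η(N^{2/3}); exactification ⟹ a hull element that is a kissing-twelve unit packing with no pair
at distance √ -/
@[route_item "route-AtomisticToContinuum-HullExactification"]
def ToyFccCrystallization : Prop :=
  Literature.Geometry.DiscreteGeometry.flyspeck_L12 → Literature.Geometry.DiscreteGeometry.FejesTothKissingTwelve → ∀ V : ℝ → ℝ, (∀ r : ℝ, 0 < r → r ≤ 199 / 200 → 1000 ≤ V r) → (∀ r : ℝ, -1 ≤ V r) → V 1 = -1 → (∀ η : ℝ, 0 < η → ∃ θ : ℝ, 0 < θ ∧ ∀ r : ℝ, 0 < r → η ≤ |r - 1| → θ - 1 ≤ V r) → (∀ r : ℝ, 201 / 200 ≤ r → 0 ≤ V r) → V (Real.sqrt 2) = 0 → V (Real.sqrt 3) = 0 → (∀ r : ℝ, 2 ≤ r → V r = 0) → (∃ β : ℝ, 0 < β ∧ ∀ r : ℝ, |r - Real.sqrt (8 / 3)| ≤ β → β ≤ V r) → Literature.MathematicalPhysics.StatisticalMechanics.HasPeriodicGroundStateEnergy V 3 ∧ Literature.MathematicalPhysics.StatisticalMechanics.IsCrystallizing V 3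

/-- item stmt-AtomisticToContinuum-4879 · assembly · rank 1 · closed · moot by None · by planner
[assembly] A → B → C → D → E → F₀ → F → G → H → 0629 → 0714 → J → Crystallization. Proof (glue):
obtain a, h, ha, hh, box, Bmat from B. (i) J gives e* ≤ liminf E(N)/N; BlancLewin2015_8_holds
identifies liminf = limsup = lim =: e; 0629 + ciInf_le (0714) give e ≤ ⨅_Q e(Q) ≤
e(hcpPeriodicConfiguration ha hh) = e*; hence e = e* = ⨅, IsLeast (range e(·)) e* and Tendsto E(N)/N
→ e(P) with P := hcpPeriodicConfiguration ha hh ⟹ HasPeriodicGroundStateEnergy lennardJones 3. (ii)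
For ground states x: D (fed by A x) gives S₁, δ; C gives the template; Bmat at δ specialised to S₁,
E at S₁ and e ≤ e* feed F₀; F gives S₂; G gives S₂ = g '' hcpStacking a h = g '' P.points
(hcpPeriodicConfiguration_points); H gives the clause ⟹ IsCrystallizing lennardJones 3.
Crystallization := ⟨(i), (ii)⟩. -/
@[route_item "route-AtomisticToContinuum-HullExactification"]
def Assembly : Prop :=
  ZeroDefectDensity → HcpLandscapeGap → RobustBarlowTemplate → HullGoodEverywhere → HullBulkOptimal → HullDefectDensityZero → HullExactShells → ExactHcpLocalTheorem → HullPeriodicCrystallizes → CrysEnergyUpper → CrysPeriodicBddBelow → HullEnergyLowerBound → Literature.MathematicalPhysics.StatisticalMechanics.Crystallization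

end Summit.AtomisticToContinuum.Crystallization.Theses.HullExactification
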